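/-
Copyright: cell pub-balaban-gaps (YM BLITZ Y1, track G1), seat g1-p2 GEN 9 (unit `pub-balaban-gaps-g1-p2`).  Row (D4) NODE O,
JUNCTION J-3 (multi-level) — PRINT'S (3.35) SHAPE AS THE HYPOTHESIS: *"there exists a gauge transformation u on □ such that
U^u = e^{iηA}, and … |A| < O(1)Mα₀(L^jη)^{−1}, |∇^ηA| < O(1)Mα₀(L^jη)^{−2}"* ([B9] p. 396), here: a site gauge `g` with
`g(y)U_μ(y)g⁻(y + e_μ) = e^{X_μ(y)}` and `X` in the (3.37) window with holomorphic entries — and the conclusion of Cor. 3.6's shape: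
the Green function of the covariant multi-level operator AT `U` ITSELF is a block walk expansion (91b's gauge transfer fed with 85∕86∕88's
exponential windows and holomorphy).  HONEST FRAMING: `(g, X)` is a hypothesis SHAPE (NOT produced from a small-plaquette condition —
that is print's [5] ∕ [B10] business, row (D2)); fundamental representation; print's unitary gauge costs 1 in operator norm, here
`r(g)r(g⁻)` (the fibre-norm dictionary); the flat operator is the lineage's scalar model ⊗ 1; VALUE letters; (D4) NOT discharged
(instance 0∕1); NOT BetaPertH, NOT continuum, NOT Clay.
-/
import Summits.QuantumFields.BalabanUV.Gaps.D4WalkBlockCovariantGaugeMultiLevel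
import Summits.QuantumFields.BalabanUV.Gaps.D4WalkBlockCovariantExpFieldHoloMultiLevel

/-!
# `Gaps.D4WalkBlockCovariantGaugeExpMultiLevel` — the Green function at a bond field GAUGE-EQUIVALENT to `e^{X}`, `X` in the (3.37)
# window: Cor. 3.6's shape at model level (cell pub-balaban-gaps, seat g1-p2 gen 9)

HONEST DEPENDENCY (cell pub-balaban, verbatim): continuum YM on T⁴ ⇐ BetaPertH ∧ nine spine estimates (0/9 proved);
BetaPertH ⇐ (D1) ∧ (D4) ∧ CAP+tail.

**`blockWalkExpansion_covariantGreen_gaugeExp_multiLevelTorus`**: for bond fields `U`, `U⁻` on [4]'s nested family, a configuration-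
independent site gauge `g` (two-sided inverse `g⁻`, row sums `≤ r′`, `≤ r`) with `g(y)U_μ(u;y)g⁻(y + e_μ) = e^{X_μ(u;y)}` and
`g(y + e_μ)U⁻_μ(u;y)g⁻(y) = e^{−X_μ(u;y)}` ((3.35)'s body, complexified), `X` with holomorphic entries in print's (3.37) window
(`Σ_c|X_μ(y)_{ac}| ≤ a₀L^{−lev y}`, `Σ_c|(X_μ(x) − X_μ(x − e_μ))_{ac}| ≤ a₁L^{−2lev x}`), contours `Γ x` connected from block base points:
the Green function `(Δ_W(U) + L^{2k}·covAvgOp(U,Γ))⁻¹` AT `U` is a block walk expansion with Cor. 3.5's walks, constants (85's, × `rr′`)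
uniform in `k`, the torus, `{Ω_j}`, the fibre, `Γ`, `g`.  (`U = g⁻e^{X}g(· + e_μ)` and `UU⁻ = 1` are CONSEQUENCES of the two gauge
relations, so no separate hypotheses on `U` are needed.)
WHAT IT IS NOT.  (g, X) from (3.35)–(3.36) ∕ small plaquettes ([5], [B10]); the adjoint representation (89 composes the same way);
(D4) instance 0∕1; words of row (D4) UNCHANGED.

References: T. Bałaban, Comm. Math. Phys. **99** (1985) 389–434 [B9], (3.35)–(3.37) p. 396, p. 398, Cor. 3.5 p. 407, Cor. 3.6 p. 408;
Comm. Math. Phys. **96** (1984) [4], (2.13)–(2.14) p. 225; Comm. Math. Phys. **116** (1988) [II], (1.11) p. 5, p. 15.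
-/

noncomputable section

namespace Summit.QuantumFields.BalabanUV.Gaps.D4WalkBlockCovariantGaugeExpMultiLevel

open Metric NormedSpace
open scoped Matrix
open Literature.MathematicalPhysics.QuantumFieldTheory.Balaban1983to89
open Literature.MathematicalPhysics.QuantumFieldTheory.Balaban1983to89.B4Reflection242 (boxDom blk)
open Literature.MathematicalPhysics.QuantumFieldTheory.Balaban1983to89.B9SectDWalk (DomBy)
open Literature.MathematicalPhysics.QuantumFieldTheory.Balaban1983to89.B9Thm34Ext (toB6)
open Literature.MathematicalPhysics.QuantumFieldTheory.Balaban1983to89.B9Thm37GlueTorus (torusGeom tdist1)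
open Literature.MathematicalPhysics.QuantumFieldTheory.Balaban1983to89.TreeLengthTorus (TPt)
open Literature.MathematicalPhysics.QuantumFieldTheory.Balaban1983to89.B5TorusCover (UT)
open Literature.MathematicalPhysics.QuantumFieldTheory.Balaban1983to89.B11SectG (RowSum)
open Literature.MathematicalPhysics.QuantumFieldTheory.Balaban1983to89.B6MultiLevelBoxOperator (N0)
open Literature.MathematicalPhysics.QuantumFieldTheory.Balaban1983to89.B6MultiLevelTorusOperator (TDomains gmlT tshift unitVec)
open Literature.MathematicalPhysics.QuantumFieldTheory.Balaban1983to89.B6Ineq243TwoLevelBox (aNext)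
open Summit.QuantumFields.BalabanUV.Gaps.D4WalkBlock (blockNorm BlockWalkExpansion)
open Summit.QuantumFields.BalabanUV.Gaps.D4WalkBlockMultiLevelGeometry (cubeML)
open Summit.QuantumFields.BalabanUV.Gaps.D4WalkBlockTransportAlgebra (rowSumNorm)
open Summit.QuantumFields.BalabanUV.Gaps.D4WalkBlockShiftStep (covLap)
open Summit.QuantumFields.BalabanUV.Gaps.D4WalkBlockShiftWeighted (covDopW covBW covAlphaW)
open Summit.QuantumFields.BalabanUV.Gaps.D4WalkBlockWeightedLettersMultiLevel (levW)
open Summit.QuantumFields.BalabanUV.Gaps.D4WalkBlockCovariantAveragingMultiLevel (covAvgOp)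
open Summit.QuantumFields.BalabanUV.Gaps.D4WalkBlockCovariantContourMultiLevel (contourT contourTi)
open Summit.QuantumFields.BalabanUV.Gaps.D4WalkBlockCovariantBondFieldMultiLevel (inv_pow_lev_tshift_symm_le)
open Summit.QuantumFields.BalabanUV.Gaps.D4WalkBlockCovariantExpFieldMultiLevel (expWindow_bond expWindow_deriv)
open Summit.QuantumFields.BalabanUV.Gaps.D4WalkBlockExpHolo (differentiableOn_exp_entry_family differentiableOn_exp_neg_entry_family)
open Summit.QuantumFields.BalabanUV.Gaps.D4WalkBlockContourPath (IsPath)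
open Summit.QuantumFields.BalabanUV.Gaps.D4WalkBlockCovariantGaugeMultiLevel (blockWalkExpansion_covariantGreen_gauge_multiLevelTorus)

variable {d : ℕ}

section Green

variable {dd N' : ℕ} {E : Type*} [NormedAddCommGroup E] [NormedSpace ℂ E]

/-- **[B9] COR. 3.6's SHAPE AT MODEL LEVEL — THE GREEN FUNCTION AT A BOND FIELD GAUGE-EQUIVALENT TO `e^{X}`, `X` IN THE (3.37)
WINDOW.**  91b's gauge transfer with the gauge-transformed pair `(e^{X}, e^{−X})`: its holomorphy by 86, its inverse identity by
`Matrix.exp_neg`, its windows by 85's `expWindow_bond` ∕ `expWindow_deriv` (`α₀ = a₀e^{a₀}`, `α₁ = a₁e^{La₀}`); the holomorphy of `U`,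
`U⁻` and `UU⁻ = 1` follow from the two gauge relations.
[cite: Balaban1985BackgroundPropagators, (3.35) p.396, (3.37) p.396, Cor. 3.5 p.407, Cor. 3.6 p.408, p.398; Balaban1984PropagatorsII, (2.13)–(2.14) p.225; Balaban1988RG2Cluster, (1.11) p.5, p.15] -/
theorem blockWalkExpansion_covariantGreen_gaugeExp_multiLevelTorus (d ℓ : ℕ) (hℓ : 1 ≤ ℓ) (aminus aplus a2minus a2plus : ℝ)
    (ha : 0 < aminus) (ha2 : 0 < a2minus) :
    ∃ δ₁ C M₀ : ℝ, ∃ N₀ : ℕ, 0 < δ₁ ∧ 0 < C ∧ 0 < M₀ ∧ 0 < N₀ ∧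
      ∀ (k Mh R : ℕ), 3 ≤ Mh → M₀ ≤ ((ℓ : ℝ) + 1) * Mh → 2 * (ℓ + 1) ≤ R → N₀ + 1 ≤ R * ((ℓ + 1) * Mh) →
      ∀ (P : Fin (d + 1) → ℕ) (hP : ∀ μ, 1 ≤ P μ) (hP4 : ∀ μ, 4 ≤ P μ) (D : TDomains d ℓ Mh k P R) (a c : ℕ → ℝ),
        (∀ i, 1 ≤ i → aminus ≤ a i ∧ a i ≤ aplus) → (∀ i, 1 ≤ i → a2minus ≤ c i ∧ c i ≤ a2plus) →
        (∀ i, 1 ≤ i → a (i + 1) = aNext ℓ (a i) (c i)) →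
      ∀ (Kc : Fin (d + 1) → ℕ) [∀ i, NeZero (Kc i)], (∀ i, N0 ℓ Mh k P i = (ℓ + 1) ^ k * Kc i) →
      ∀ (N : ℕ) (c₀ : B13.Consts) (Xs : Finset (UT Kc)) (Rb : ℝ)
        (U Ui X : Fin (d + 1) → E → ↥(boxDom (N0 ℓ Mh k P)) → Matrix (Fin N) (Fin N) ℂ)
        (Γ : ↥(boxDom (N0 ℓ Mh k P)) → List (↥(boxDom (N0 ℓ Mh k P)) × Fin (d + 1)))
        (β : ↥(boxDom (N0 ℓ Mh k P)) → ↥(boxDom (N0 ℓ Mh k P))) (g gi : ↥(boxDom (N0 ℓ Mh k P)) → Matrix (Fin N) (Fin N) ℂ)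
        (r r' a₀ a₁ ε μ cμ : ℝ),
      (∀ x, g x * gi x = 1) → (∀ x, gi x * g x = 1) → 0 ≤ r → 0 ≤ r' → (∀ x a', ∑ b, ‖gi x a' b‖ ≤ r) →
      (∀ x a', ∑ b, ‖g x a' b‖ ≤ r') →
      (∀ x, IsPath (fun ν => tshift (N0 ℓ Mh k P) (unitVec ν)) (Γ x) (β x) x) →
      (∀ x x' : ↥(boxDom (N0 ℓ Mh k P)), blk ((ℓ + 1) ^ D.lev x.1) x'.1 = blk ((ℓ + 1) ^ D.lev x.1) x.1 → β x' = β x) →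
      (∀ ν u y, g y * U ν u y * gi ((tshift (N0 ℓ Mh k P) (unitVec ν)) y) = exp (X ν u y)) →
      (∀ ν u y, g ((tshift (N0 ℓ Mh k P) (unitVec ν)) y) * Ui ν u y * gi y = exp (-X ν u y)) →
      (∀ ν y a' b, DifferentiableOn ℂ (fun u => X ν u y a' b) (ball (0 : E) Rb)) → 0 ≤ a₀ → 0 ≤ a₁ →
      (∀ ν, ∀ u ∈ ball (0 : E) Rb, ∀ y a', rowSumNorm (X ν u y) a' ≤ a₀ * ((((ℓ : ℝ) + 1) ^ D.lev y.1))⁻¹) →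
      (∀ ν, ∀ u ∈ ball (0 : E) Rb, ∀ x a', rowSumNorm (X ν u x - X ν u ((tshift (N0 ℓ Mh k P) (unitVec ν)).symm x)) a' ≤
        a₁ * ((((ℓ : ℝ) + 1) ^ D.lev x.1))⁻¹ ^ 2) →
      (∀ x, (Γ x).length ≤ (d + 1) * (ℓ + 1) ^ D.lev x.1) →
      (∀ x, ∀ b ∈ Γ x, blk ((ℓ + 1) ^ D.lev x.1) b.1.1 = blk ((ℓ + 1) ^ D.lev x.1) x.1) →
      0 ≤ μ → 2 * μ ≤ ε → 2 * μ ≤ δ₁ - ε - μ → 0 ≤ cμ →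
      RowSum (toB6 (torusGeom Kc 0 0 0) 0 True) μ cμ →
      cμ * (cμ * 1 * (1 * ((0 + ∑ j : Unit ⊕ (Fin (d + 1) ⊕ Fin (d + 1)),
        covAlphaW (((ℓ : ℝ) + 1) * (a₀ * Real.exp a₀)) (((d : ℝ) + 1) * ((a₁ * Real.exp (((ℓ : ℝ) + 1) * a₀)) + (((ℓ : ℝ) + 1) * (a₀ * Real.exp a₀)) ^ 2) +
          aplus * (Real.exp (2 * ((d : ℝ) + 1) * (a₀ * Real.exp a₀)) - 1)) j * covBW δ₁ ((ℓ : ℝ) + 1) j) * C)) * cμ) * cμ < 1 →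
      ∃ (W : Type) (T : W → (TPt dd N' → ℂ) → E → Matrix (↥(boxDom (N0 ℓ Mh k P)) × Fin N) (↥(boxDom (N0 ℓ Mh k P)) × Fin N) ℂ)
        (SX' : Set W) (A' : W → ℝ) (D' : W → UT Kc → UT Kc → ℝ),
        BlockWalkExpansion c₀ (fun q : ↥(boxDom (N0 ℓ Mh k P)) × Fin N => cubeML ℓ k Kc q.1.1)
          (fun q : ↥(boxDom (N0 ℓ Mh k P)) × Fin N => cubeML ℓ k Kc q.1.1)
          (fun (_ : TPt dd N' → ℂ) u =>
            (covLap ↥(boxDom (N0 ℓ Mh k P)) (Fin N) (fun ν => tshift (N0 ℓ Mh k P) (unitVec ν)) ((((ℓ : ℝ) + 1) ^ k)⁻¹)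
                (fun ν u x => U ν u x - 1) (fun ν u x => Ui ν u ((tshift (N0 ℓ Mh k P) (unitVec ν)).symm x) - 1) u +
              (((ℓ : ℂ) + 1) ^ (2 * k) : ℂ) • covAvgOp D a (contourT Γ fun u b => U b.2 u b.1) (contourTi Γ fun u b => Ui b.2 u b.1) u)⁻¹)
          Xs Rb (ε - 2 * μ) (δ₁ - ε - μ - 2 * μ)
          (r * r' * (cμ * C * (1 * (1 - cμ * (cμ * 1 * (1 * ((0 + ∑ j : Unit ⊕ (Fin (d + 1) ⊕ Fin (d + 1)),
            covAlphaW (((ℓ : ℝ) + 1) * (a₀ * Real.exp a₀)) (((d : ℝ) + 1) * ((a₁ * Real.exp (((ℓ : ℝ) + 1) * a₀)) + (((ℓ : ℝ) + 1) * (a₀ * Real.exp a₀)) ^ 2) +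
              aplus * (Real.exp (2 * ((d : ℝ) + 1) * (a₀ * Real.exp a₀)) - 1)) j * covBW δ₁ ((ℓ : ℝ) + 1) j) * C)) * cμ) * cμ)⁻¹) * cμ))
          T SX' A' D' (δ₁ - 2 * μ) ∧
        ∀ ω, DomBy (toB6 (torusGeom Kc 0 0 0) 0 True) (D' ω) := by
  obtain ⟨δ₁, C, M₀, N₀, hδ₁, hC, hM₀, hN₀, hmain⟩ :=
    blockWalkExpansion_covariantGreen_gauge_multiLevelTorus (dd := dd) (N' := N') (E := E) d ℓ hℓ aminus aplus a2minus a2plus ha ha2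
  refine ⟨δ₁, C, M₀, N₀, hδ₁, hC, hM₀, hN₀, ?_⟩
  intro k Mh R hMh hM hR hRM P hP hP4 D a c haw hcw hac Kc _ hKc N c₀ Xs Rb U Ui X Γ β g gi r r' a₀ a₁ ε μ cμ hg hgi hr0 hr0' hr
    hr' hpath hβ hgauge hgaugei hXh ha₀ ha₁ hX0 hX1 hlen hblkΓ hμ hμε hμκ hcμ hrow hq
  have hMh1 : 1 ≤ Mh := le_trans (by norm_num) hMh
  have hR1 : 1 ≤ R := le_trans (by omega) hR
  -- U and U⁻ recovered from the gauge relations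
  have hU : ∀ ν u y, U ν u y = gi y * exp (X ν u y) * g ((tshift (N0 ℓ Mh k P) (unitVec ν)) y) := by
    intro ν u y
    rw [← hgauge ν u y]
    simp only [← Matrix.mul_assoc]
    rw [hgi, Matrix.one_mul, Matrix.mul_assoc, hgi, Matrix.mul_one]
  have hUi : ∀ ν u y, Ui ν u y = gi ((tshift (N0 ℓ Mh k P) (unitVec ν)) y) * exp (-X ν u y) * g y := by
    intro ν u y
    rw [← hgaugei ν u y]
    simp only [← Matrix.mul_assoc]
    rw [hgi, Matrix.one_mul, Matrix.mul_assoc, hgi, Matrix.mul_one]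
  have hc : ∀ (M : Matrix (Fin N) (Fin N) ℂ) a' b, DifferentiableOn ℂ (fun _ : E => M a' b) (ball (0 : E) Rb) := fun M a' b =>
    differentiableOn_const _
  have hEh := differentiableOn_exp_entry_family hXh
  have hEih := differentiableOn_exp_neg_entry_family hXh
  have hUh : ∀ ν y a' b, DifferentiableOn ℂ (fun u => U ν u y a' b) (ball (0 : E) Rb) := by
    intro ν y a' b
    simp only [hU]
    exact D4WalkProduct.differentiableOn_mul_entry (M₁ := fun u => gi y * exp (X ν u y))
      (D4WalkProduct.differentiableOn_mul_entry (hc (gi y)) (hEh ν y)) (hc _) a' b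
  have hUih : ∀ ν y a' b, DifferentiableOn ℂ (fun u => Ui ν u y a' b) (ball (0 : E) Rb) := by
    intro ν y a' b
    simp only [hUi]
    exact D4WalkProduct.differentiableOn_mul_entry (M₁ := fun u => gi _ * exp (-X ν u y))
      (D4WalkProduct.differentiableOn_mul_entry (hc (gi _)) (hEih ν y)) (hc _) a' b
  have hexp : ∀ ν u y, exp (X ν u y) * exp (-X ν u y) = 1 := fun ν u y => by
    rw [Matrix.exp_neg]; exact Matrix.mul_nonsing_inv _ ((Matrix.isUnit_iff_isUnit_det _).1 (Matrix.isUnit_exp _))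
  have hinv : ∀ ν u y, U ν u y * Ui ν u y = 1 := by
    intro ν u y
    rw [hU, hUi]
    calc gi y * exp (X ν u y) * g ((tshift (N0 ℓ Mh k P) (unitVec ν)) y) *
          (gi ((tshift (N0 ℓ Mh k P) (unitVec ν)) y) * exp (-X ν u y) * g y)
        = gi y * exp (X ν u y) * (g ((tshift (N0 ℓ Mh k P) (unitVec ν)) y) * gi ((tshift (N0 ℓ Mh k P) (unitVec ν)) y)) *
            exp (-X ν u y) * g y := by simp only [Matrix.mul_assoc]
      _ = 1 := by rw [hg, Matrix.mul_one, Matrix.mul_assoc (gi y), hexp, Matrix.mul_one, hgi]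
  -- the (3.37) windows of the gauge-transformed pair = those of (e^{X}, e^{−X}) (85 §1)
  obtain ⟨hE0, hEi0⟩ := expWindow_bond (D := D) (X := X) ha₀ hX0
  have hE1 := expWindow_deriv (D := D) (X := X) hR1 hMh1 hP ha₀ ha₁ hX0 hX1
  exact hmain k Mh R hMh hM hR hRM P hP hP4 D a c haw hcw hac Kc hKc (Fin N) c₀ Xs Rb U Ui Γ β g gi r r' (a₀ * Real.exp a₀)
    (a₁ * Real.exp (((ℓ : ℝ) + 1) * a₀)) ε μ cμ hg hgi hr0 hr0' hr hr' hpath hβ hUh hUih hinv (by positivity) (by positivity)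
    (fun ν u hu y a' => by rw [hgauge]; exact hE0 ν u hu y a') (fun ν u hu y a' => by rw [hgaugei]; exact hEi0 ν u hu y a')
    (fun ν u hu x a' => by rw [hgauge, hgauge]; exact hE1 ν u hu x a') hlen hblkΓ hμ hμε hμκ hcμ hrow hq

end Green

end Summit.QuantumFields.BalabanUV.Gaps.D4WalkBlockCovariantGaugeExpMultiLevel

end
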